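import Literature.AnabelianGeometry.AbsoluteAnabelian.AbsTopII.EllipticCuspidalizationComparison
import Literature.AnabelianGeometry.AbsoluteAnabelian.AbsTopI.ChainTransportThm
import Literature.AnabelianGeometry.AbsoluteAnabelian.AbsTopIChainsIsoCompat
import Literature.AnabelianGeometry.AbsoluteAnabelian.AbsTopIThm214GroupPartProofs
import Literature.AnabelianGeometry.AbsoluteAnabelian.SlimTransport
import HarnessLib

/-!
# [AbsTopII] Cor 3.3 (i) in BI-ANABELIAN form: an isomorphism of extensions `Π ⥲ Π′` of two members extends,
# compatibly with `Π ⊆ Π_C`, `Π′ ⊆ Π_{C′}`, to an isomorphism of the `k`-cores `Π_C ⥲ Π_{C′}` (proof-only)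

S. Mochizuki, *Topics in Absolute Anabelian Geometry II: Decomposition Groups and Endomorphisms* [AbsTopII],
Cor 3.3 (i) pp. 67–68 and Remark 3.3.2 p. 69 (manuscript pagination, lit key `paper:url-585b8d0ad0d9`):
"the finite étale covering `X_{k'} → C` determines a chain … whose image `Π' ⇝ Π_C` in `Chain(Π')` may be characterized
'group-theoretically', up to isomorphism in `Chain(Π')`, as the unique chain of length `1` in `Chain(Π')`, with associated
type-chain `⋎`, such that the resulting object of `ÉtLoc(Π')` forms a terminal object of `ÉtLoc(Π')`"; Rmk 3.3.2: such
group-theoretic characterizations are preserved by arbitrary isomorphisms of profinite groups.  *Topics … I* [AbsTopI],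
Thm 4.7 (ii) p. 57: an isomorphism of extensions `φ` induces `ÉtLoc(Π₁) ⥲ ÉtLoc(Π₂)` compatible with type-chains.
[cite: MochizukiAbsTopII2013, Cor 3.3 (i) p.67]

PROOF-ONLY companion (abc-iut cell; L5 ROWS #5 row R7 «COR12-ABSTOPII-COR33-ADAPTER», seat abc-iut-w6-d032 gen 6; no `def`,
no `instance`; abc-iut-L4-t6's `AbsTopII.EllipticModel` / `IsCor33Member` / `RealizesCore` / `Cor_3_3_i`
(`EllipticCuspidalizationComparison.lean`), the chain predicates `IsProSigmaChain` / `IsEtLocTerminalFor` /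
`LastTermsIsomorphic` (`CuspidalizationComparison.lean`, `CuspidalizationChains.lean`) and the [AbsTopI] Thm 4.7 (ii)
transport kit of `AbsTopI/ChainTransport*.lean` (`transportTerms`, `transportTermsIso`, `isElemOp_*_transfer`,
`ChainGroupIsoOver`, `PiChainIsoOver`) are consumed BY NAME, never edited or restated).

WHY ([IUTchI] Cor 1.2 p. 39 l. 24–27 «the algorithms of [AbsTopII], Corollary 3.3, (i), (ii) … allow one to reconstruct
`Π_C` [together with the natural inclusion `Π_{X̲→} ↪ Π_C`]»; plan/L5/SUBDAG-IUTchI-Cor12.md §A laws 5–6): the Cor 1.2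
certificate conjunct `Summit.ABC.IUTFork.Conditional.layer5_held_cor12_v6` binds the PURE EXTENSION form `hext` / `hextC`
(«every bicontinuous isomorphism `Π_{X̲→} ⥲ Π′_{X̲→}` extends to `Π_C ⥲ Π′_C`»), whereas the tree's [AbsTopII] Cor 3.3 (i)
(FACT-LIST F-0294) is the printed MONO-anabelian characterization relative to a model `(𝒟, M)`.  This file is the
group-theoretic bridge between the two shapes:

* `AbsTopI.exists_isoOver_of_ne_deCusp` — transport of a `Π_E`-chain WITHOUT de-cuspidalization steps (in particular every
  `ÉtLoc`-object, every `⋎`-chain) along `φ : E ≅ F` to a `Π_F`-chain over ANY cuspidal data on `F` (the cuspidal-data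
  compatibility of `exists_isoOver` is needed for type • only);
* `AbsTopI.PiChainIsoOver.isProSigmaChain_transfer`, `….isEtLocTerminalFor_transfer` — condition (3_Π) and
  `ÉtLoc`-terminality (the pro-`Σ` reading `IsEtLocTerminalFor` of abc-iut-L4-t6) are invariant under chain isomorphisms
  over `φ` ([AbsTopII] Rmk 3.3.2 / [AbsTopI] Thm 4.7 (ii): "the definitions … are entirely group-theoretic");
* **`AbsTopII.EllipticModel.exists_coreIso_extending_of_cor_3_3_i`** — for an `EllipticModel M` over a class `𝒟` satisfying
  the `𝒟`-hypotheses, [AbsTopII] Cor 3.3 (i) AS TYPED (`M.Cor_3_3_i`, taken BY NAME) implies: for members `X`, `X′` (standing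
  hypotheses `IsCor33Member`, same prime set `Σ`) and ANY isomorphism of extensions `Φ : Π_X ⥲ Π_{X′}`, there is an
  isomorphism of topological groups `Θ : Π_C ⥲ Π_{C′}` of the `k`-cores with `Θ ∘ (Π_X ↪ Π_C) = (Π_{X′} ↪ Π_{C′}) ∘ Φ`.
  Route = the printed one: the terminal `⋎`-chain of `X` transported along `Φ` is again pro-`Σ`, of type-chain `⋎` and
  `ÉtLoc`-terminal, hence (uniqueness clause of Cor 3.3 (i) at `X′`) isomorphic in `Chain(Π_{X′})` to the terminal chain of
  `X′`; the composite `Π_C ≅ Πₙ ≅ Πₙ′ ≅ Π_{C′}` agrees with `Φ` on an OPEN subgroup of `Π_X` (rigidification domains), and slim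
  rigidity of `Π_{C′}` (`IsSlimGroup.eq_of_eqOn_of_isOpen_map`, [AbsTopI] Def 4.2 (iv) "[since all of the profinite groups
  involved are slim]") upgrades this to all of `Π_X`.

HONEST FRAMING: CONDITIONAL on the named fact `M.Cor_3_3_i` (F-0294, unproved, admissible by name) and MODEL-RELATIVE
(no instance of `EllipticModel` exists in the tree); typed ≠ proved; nothing here bears on [IUTchIII] Cor 3.12 or
asserts that abc is proved or refuted.
-/

noncomputable section

open CategoryTheory Topology
open scoped Pointwise

universe u

namespace Literature.AnabelianGeometry.AbsoluteAnabelian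

open Literature.AlgebraicGeometry.Frobenioids (IsSlimGroup)
open FundamentalExtension

/-! ### 1. Transport of chains without de-cuspidalization steps -/

namespace AbsTopI

variable {E F : FundamentalExtension.{u}} (φ : E ≅ F)
  {C₁ : CuspidalData E} {hP₁ : IsSlimGroup E.arith} {hΔ₁ : IsSlimGroup E.geom} {hne₁ : E.geom ≠ ⊥}

/-- An elementary operation of type `⋏`, `⋎` or `⊚` transfers along term isomorphisms over `φ` for ARBITRARY cuspidal data
on the two sides (only type • reads the cuspidal data). [cite: MochizukiAbsTopI2012, Thm 4.7 (ii) p.57] -/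
theorem isElemOp_transfer_of_ne_deCusp {C₂ : CuspidalData F} {t : ElemOpType} (ht : t ≠ .deCusp)
    {L L' : E.ChainGroup} {M M' : F.ChainGroup} (I : ChainGroupIsoOver φ L M) (I' : ChainGroupIsoOver φ L' M')
    (h : ChainGroup.IsElemOp C₁ t L L') : ChainGroup.IsElemOp C₂ t M M' := by
  cases t with
  | finEtCov => exact isElemOp_finEtCov_transfer I I' h
  | finEtQuot => exact isElemOp_finEtQuot_transfer I I' h
  | deCusp => exact absurd rfl ht
  | deOrb => exact isElemOp_deOrb_transfer I I' h

/-- **Transport of a chain with no • step along an isomorphism of extensions, over ANY cuspidal data on the target**: every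
`Π_E`-chain none of whose elementary operations is a de-cuspidalization is `φ`-isomorphic to a `Π_F`-chain (terms
`transportTerms`: `Π_F` at index `0`, the same profinite groups elsewhere). [cite: MochizukiAbsTopI2012, Thm 4.7 (ii) p.57] -/
theorem exists_isoOver_of_ne_deCusp (C₂ : CuspidalData F) (hP₂ : IsSlimGroup F.arith) (hΔ₂ : IsSlimGroup F.geom)
    (hne₂ : F.geom ≠ ⊥) (c : E.PiChain C₁ hP₁ hΔ₁ hne₁) (hc : ∀ j, c.types j ≠ .deCusp) :
    ∃ c₂ : F.PiChain C₂ hP₂ hΔ₂ hne₂, PiChainIsoOver φ c c₂ := by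
  let T : TargetData F := ⟨C₂, hP₂, hΔ₂, hne₂⟩
  refine ⟨{ len := c.len
            term := transportTerms φ T c
            term_zero := rfl
            types := c.types
            isElemOp := fun j =>
              isElemOp_transfer_of_ne_deCusp φ (hc j) (transportTermsIso φ T c j.castSucc)
                (transportTermsIso φ T c j.succ) (c.isElemOp j) }, rfl, fun j₁ j₂ hj => ?_, fun j₁ j₂ hj => ?_⟩
  · have : j₁ = j₂ := Fin.ext hj
    subst this
    rfl
  · have : j₁ = j₂ := Fin.ext hj
    subst this
    exact ⟨transportTermsIso φ T c j₁⟩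

/-- An `ÉtLoc`-object has no • step. [cite: MochizukiAbsTopI2012, Def 4.2 (v) p.51] -/
theorem ne_deCusp_of_isEtLocObj (c : E.PiChain C₁ hP₁ hΔ₁ hne₁) (hc : c.IsEtLocObj) (j : Fin c.len) :
    c.types j ≠ .deCusp := by
  intro h
  have hj := hc j
  rw [h] at hj
  rcases hj with hj | hj <;> exact ElemOpType.noConfusion hj

/-- A chain with type-chain `⋎` (a length-`1` chain of type `[finEtQuot]`, as in [AbsTopII] Cor 3.3 (i)) has no • step.
[cite: MochizukiAbsTopII2013, Cor 3.3 (i) p.67] -/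
theorem ne_deCusp_of_typeChain_eq_finEtQuot (c : E.PiChain C₁ hP₁ hΔ₁ hne₁)
    (hc : c.typeChain = [ElemOpType.finEtQuot]) (j : Fin c.len) : c.types j ≠ .deCusp := by
  intro h
  have hmem : c.types j ∈ c.typeChain := by
    unfold PiChain.typeChain
    rw [List.mem_ofFn]
    exact ⟨j, rfl⟩
  rw [hc, List.mem_singleton, h] at hmem
  exact ElemOpType.noConfusion hmem

/-! ### 2. Invariance of (3_Π), of injective terminal homomorphisms and of `ÉtLoc`-terminality -/

namespace PiChainIsoOver

variable {φ} {C₂ : CuspidalData F} {hP₂ : IsSlimGroup F.arith} {hΔ₂ : IsSlimGroup F.geom} {hne₂ : F.geom ≠ ⊥}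
  {c₁ : E.PiChain C₁ hP₁ hΔ₁ hne₁} {c₂ : F.PiChain C₂ hP₂ hΔ₂ hne₂}

/-- **Condition (3_Π) is invariant**: if `c₁ ≅ c₂` over `φ` and every `Δⱼ` of `c₁` is pro-`Σ`, so is every `Δⱼ` of `c₂`
(a term isomorphism restricts to `Δⱼ ≃ Δⱼ′`, `ChainGroupIsoOver.geomJEquiv`). [cite: MochizukiAbsTopII2013, Cor 3.3 p.67] -/
theorem isProSigmaChain_transfer (h : PiChainIsoOver φ c₁ c₂) {S : Set ℕ} (hc : AbsTopII.IsProSigmaChain S c₁) :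
    AbsTopII.IsProSigmaChain S c₂ := by
  intro j₂
  obtain ⟨hlen, -, hterms⟩ := h
  obtain ⟨I⟩ := hterms ⟨j₂.val, by omega⟩ j₂ rfl
  let e : (c₁.term ⟨j₂.val, by omega⟩).geomJ ≃ₜ* (c₂.term j₂).geomJ :=
    { I.geomJEquiv with
      continuous_toFun := I.continuous_geomJEquiv
      continuous_invFun := I.continuous_geomJEquiv_symm }
  exact IsProSet.of_continuousMulEquiv e (hc _)

end PiChainIsoOver

/-- Transfer of an INJECTIVE terminal homomorphism `t : Ψₘ → Πₙ` ([AbsTopI] Def 4.2 (iv); injective with open image and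
compatible with the projections to `G` up to `g ∈ G`) along term isomorphisms over `φ`: `I ∘ t ∘ J⁻¹` is again injective
with open image and compatible up to `φ_G(g)`. [cite: MochizukiAbsTopI2012, Thm 4.7 (ii) p.57] -/
theorem exists_injTerminalHom_transfer {L L' : E.ChainGroup} {M M' : F.ChainGroup}
    (J : ChainGroupIsoOver φ L' M') (I : ChainGroupIsoOver φ L M) (t : L'.grp →ₜ* L.grp) (g : E.gal)
    (hinj : Function.Injective t) (hopen : IsOpen (Set.range t))
    (hcompat : ∀ x, L.proj (t x) = MulAut.conj g (L'.proj x)) :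
    ∃ t₂ : M'.grp →ₜ* M.grp, (∀ y, t₂ y = I.iso (t (J.iso.symm y))) ∧ Function.Injective t₂ ∧
      IsOpen (Set.range t₂) ∧ ∀ y, M.proj (t₂ y) = MulAut.conj (φ.hom.gal g) (M'.proj y) := by
  let t₂ : M'.grp →ₜ* M.grp :=
    { toMonoidHom := I.iso.toMonoidHom.comp (t.toMonoidHom.comp J.iso.symm.toMonoidHom)
      continuous_toFun := I.iso.continuous.comp (t.continuous.comp J.iso.symm.continuous) }
  have ht₂ : ∀ y, t₂ y = I.iso (t (J.iso.symm y)) := fun _ => rfl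
  refine ⟨t₂, ht₂, ?_, ?_, fun y => ?_⟩
  · intro a b hab
    rw [ht₂, ht₂] at hab
    exact J.iso.symm.injective (hinj (I.iso.injective hab))
  · have hr : Set.range t₂ = I.iso.toHomeomorph '' Set.range t := by
      ext z
      simp only [Set.mem_range, Set.mem_image]
      constructor
      · rintro ⟨y, rfl⟩
        exact ⟨t (J.iso.symm y), ⟨J.iso.symm y, rfl⟩, rfl⟩
      · rintro ⟨_, ⟨x, rfl⟩, rfl⟩
        exact ⟨J.iso x, by rw [ht₂, ContinuousMulEquiv.symm_apply_apply]; rfl⟩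
    rw [hr]
    exact I.iso.toHomeomorph.isOpenMap _ hopen
  · rw [ht₂, I.proj_comm, hcompat, MulAut.conj_apply, MulAut.conj_apply, map_mul, map_mul, map_inv,
      ← J.proj_comm (J.iso.symm y), ContinuousMulEquiv.apply_symm_apply]

namespace PiChainIsoOver

variable {φ} {C₂ : CuspidalData F} {hP₂ : IsSlimGroup F.arith} {hΔ₂ : IsSlimGroup F.geom} {hne₂ : F.geom ≠ ⊥}
  {c₁ : E.PiChain C₁ hP₁ hΔ₁ hne₁} {c₂ : F.PiChain C₂ hP₂ hΔ₂ hne₂}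

/-- **`ÉtLoc`-terminality (pro-`Σ` reading) is invariant under chain isomorphisms over `φ`** ([AbsTopII] Rmk 3.3.2: the
characterization of Cor 3.3 (i) is group-theoretic; [AbsTopI] Thm 4.7 (ii)): an `ÉtLoc(Π_F)`-object is transported back
along `φ⁻¹` (no cuspidal-data compatibility is needed for `⋏`/`⋎`-chains), its injective terminal homomorphism to `c₁`
is transported forward, and uniqueness up to an inner automorphism of the target is transported likewise.
[cite: MochizukiAbsTopII2013, Cor 3.3 (i) p.67] -/
theorem isEtLocTerminalFor_transfer (h : PiChainIsoOver φ c₁ c₂) {S : Set ℕ} (ht : AbsTopII.IsEtLocTerminalFor S c₁) :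
    AbsTopII.IsEtLocTerminalFor S c₂ := by
  intro d₂ hd₂ hd₂S
  -- transport `d₂` back to a `Π_E`-chain `d₁ ≅ d₂` over `φ`
  obtain ⟨d₁, hd'⟩ := exists_isoOver_of_ne_deCusp φ.symm C₁ hP₁ hΔ₁ hne₁ d₂ (ne_deCusp_of_isEtLocObj d₂ hd₂)
  have hd : PiChainIsoOver φ d₁ d₂ := PiChainIsoOver.of_eq (Iso.symm_symm_eq φ) hd'.symm
  have hd₁ : d₁.IsEtLocObj := (hd.typesAmong_iff _).mpr hd₂
  have hd₁S : AbsTopII.IsProSigmaChain S d₁ := hd'.isProSigmaChain_transfer hd₂S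
  obtain ⟨I⟩ := h.nonempty_last
  obtain ⟨J⟩ := hd.nonempty_last
  obtain ⟨⟨t, g, hinj, hopen, hcompat⟩, huniq⟩ := ht d₁ hd₁ hd₁S
  refine ⟨?_, fun s₂ s₂' g₂ g₂' hs₂i hs₂o hs₂c hs₂'i hs₂'o hs₂'c => ?_⟩
  · obtain ⟨t₂, -, ht₂i, ht₂o, ht₂c⟩ := exists_injTerminalHom_transfer φ J I t g hinj hopen hcompat
    exact ⟨t₂, φ.hom.gal g, ht₂i, ht₂o, ht₂c⟩
  · -- pull the two homomorphisms back along `φ⁻¹`, compare there, push the conjugating element forward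
    obtain ⟨s, hs, hsi, hso, hsc⟩ :=
      exists_injTerminalHom_transfer φ.symm J.symm I.symm s₂ g₂ hs₂i hs₂o hs₂c
    obtain ⟨s', hs', hs'i, hs'o, hs'c⟩ :=
      exists_injTerminalHom_transfer φ.symm J.symm I.symm s₂' g₂' hs₂'i hs₂'o hs₂'c
    obtain ⟨u, hu⟩ := huniq s s' (φ.symm.hom.gal g₂) (φ.symm.hom.gal g₂') hsi hso hsc hs'i hs'o hs'c
    refine ⟨I.iso u, fun y => ?_⟩
    have e1 : s (J.iso.symm y) = I.iso.symm (s₂ y) := by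
      rw [hs]
      change I.iso.symm (s₂ (J.iso.symm.symm (J.iso.symm y))) = _
      rw [ContinuousMulEquiv.symm_symm, ContinuousMulEquiv.apply_symm_apply]
    have e2 : s' (J.iso.symm y) = I.iso.symm (s₂' y) := by
      rw [hs']
      change I.iso.symm (s₂' (J.iso.symm.symm (J.iso.symm y))) = _
      rw [ContinuousMulEquiv.symm_symm, ContinuousMulEquiv.apply_symm_apply]
    have e3 := hu (J.iso.symm y)
    rw [e1, e2] at e3
    have e4 := congrArg I.iso e3
    rw [ContinuousMulEquiv.apply_symm_apply, map_mul, map_mul, map_inv, ContinuousMulEquiv.apply_symm_apply] at e4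
    exact e4

end PiChainIsoOver

end AbsTopI

/-! ### 3. [AbsTopII] Cor 3.3 (i) ⇒ the bi-anabelian core extension -/

namespace AbsTopII

namespace EllipticModel

open AbsTopI

variable {𝒟 : ConstructionDataClass.{u}} (M : EllipticModel 𝒟)

/-- **[AbsTopII] Cor 3.3 (i), bi-anabelian form** ([AbsTopII] Cor 3.3 (i) pp. 67–68 with Rmk 3.3.2 p. 69; the shape
[IUTchI] Cor 1.2 p. 39 l. 24–27 consumes: «reconstruct `Π_C` [together with the natural inclusion `Π_{X̲→} ↪ Π_C`]»).
Relative to `(𝒟, M)` under the `𝒟`-hypotheses, GIVEN the named fact `M.Cor_3_3_i` (F-0294): for members `X` over `k_b`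
and `X′` over `k_{b′}` satisfying the standing hypotheses, with the same prime set `Σ`, and ANY isomorphism of extensions
`Φ : (Π_X ↠ G) ⥲ (Π_{X′} ↠ G′)`, there is an isomorphism of topological groups `Θ : Π_C ⥲ Π_{C′}` between the `k`-cores
with `Θ ∘ (Π_X ↪ Π_C) = (Π_{X′} ↪ Π_{C′}) ∘ Φ`.  Proof: transport of the terminal `⋎`-chain along `Φ` + the uniqueness
clause of Cor 3.3 (i) at `X′` + slim rigidity of `Π_{C′}`. [cite: MochizukiAbsTopII2013, Cor 3.3 (i) p.67] -/
theorem exists_coreIso_extending_of_cor_3_3_i (h33 : M.Cor_3_3_i) (hfull : 𝒟.IsChainFull) (hdgc : 𝒟.RelIsomDGC)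
    {b b' : 𝒟.Base} {X : (𝒟.datum b).Obj} {X' : (𝒟.datum b').Obj} (hX : M.IsCor33Member b X)
    (hX' : M.IsCor33Member b' X') (hS : (𝒟.datum b').primes = (𝒟.datum b).primes)
    (Φ : (𝒟.datum b).ext X ≅ (𝒟.datum b').ext X') :
    ∃ Θ : (M.coreExt b X).arith ≃ₜ* (M.coreExt b' X').arith,
      ∀ x, Θ ((M.toCore b X).arith x) = (M.toCore b' X').arith (Φ.hom.arith x) := by
  obtain ⟨c, hcS, ⟨hct, e, -, herig⟩, hcT, -⟩ := h33 hfull hdgc b X hX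
  obtain ⟨c', -, ⟨-, e', -, he'rig⟩, -, hc'U⟩ := h33 hfull hdgc b' X' hX'
  -- transport the terminal chain of `X` along `Φ` (a `⋎`-chain: no cuspidal-data compatibility needed)
  obtain ⟨c₂, hc₂⟩ := exists_isoOver_of_ne_deCusp Φ (M.cusps b' X') hX'.arith_slim hX'.geom_slim hX'.geom_ne_bot c
    (ne_deCusp_of_typeChain_eq_finEtQuot c hct)
  have hc₂S : IsProSigmaChain (𝒟.datum b').primes c₂ := by
    rw [hS]
    exact hc₂.isProSigmaChain_transfer hcS
  have hc₂t : c₂.typeChain = [ElemOpType.finEtQuot] := hc₂.typeChain_eq ▸ hct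
  have hc₂T : IsEtLocTerminalFor (𝒟.datum b').primes c₂ := by
    rw [hS]
    exact hc₂.isEtLocTerminalFor_transfer hcT
  -- uniqueness of Cor 3.3 (i) at `X′`: the transported chain is isomorphic in `Chain(Π_{X′})` to the terminal chain of `X′`
  obtain ⟨f, -, U, hUo, hU, hU', hf⟩ := hc'U c₂ hc₂S hc₂t hc₂T
  obtain ⟨I⟩ := hc₂.nonempty_last
  obtain ⟨V, hVo, hV₁, hV₂, hI⟩ := I.rig_comm
  -- the candidate `Θ : Π_C ≅ Πₙ ≅ (transport) ≅ Πₙ′ ≅ Π_{C′}`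
  let Θ : (M.coreExt b X).arith ≃ₜ* (M.coreExt b' X').arith := e.symm.trans (I.iso.trans (f.trans e'))
  refine ⟨Θ, ?_⟩
  -- (a) `Θ` agrees with `Φ` on the open subgroup `W = V ∩ Φ⁻¹(U)` of `Π_X`
  let W : Subgroup ((𝒟.datum b).ext X).arith := V ⊓ U.comap Φ.hom.arith.toMonoidHom
  have hWo : IsOpen (W : Set ((𝒟.datum b).ext X).arith) := by
    change IsOpen ((V : Set _) ∩ Φ.hom.arith.toMonoidHom ⁻¹' (U : Set _))
    exact hVo.inter (hUo.preimage Φ.hom.arith.continuous)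
  have hagree : ∀ x ∈ W, Θ ((M.toCore b X).arith x) = (M.toCore b' X').arith (Φ.hom.arith x) := by
    intro x hx
    have hxV : x ∈ V := hx.1
    have hxU : Φ.hom.arith x ∈ U := hx.2
    have h1 : e.symm ((M.toCore b X).arith x) = c.last.rig ⟨x, hV₁ hxV⟩ := by
      rw [ContinuousMulEquiv.symm_apply_eq]
      exact (herig ⟨x, hV₁ hxV⟩).symm
    have h2 : I.iso (c.last.rig ⟨x, hV₁ hxV⟩) = c₂.last.rig ⟨Φ.hom.arith x, hV₂ ⟨x, hxV, rfl⟩⟩ := hI ⟨x, hxV⟩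
    have h3 : f (c₂.last.rig ⟨Φ.hom.arith x, hU hxU⟩) = c'.last.rig ⟨Φ.hom.arith x, hU' hxU⟩ := hf ⟨Φ.hom.arith x, hxU⟩
    have h4 : e' (c'.last.rig ⟨Φ.hom.arith x, hU' hxU⟩) = (M.toCore b' X').arith (Φ.hom.arith x) := he'rig ⟨_, hU' hxU⟩
    change e' (f (I.iso (e.symm ((M.toCore b X).arith x)))) = _
    rw [h1, h2]
    exact (congrArg e' h3).trans h4
  -- (b) slim rigidity of `Π_{C′}` (slim as a chain term, transported along `e′`) upgrades the agreement to all of `Π_X`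
  have hslim : IsSlimGroup (M.coreExt b' X').arith := isSlimGroup_of_continuousMulEquiv e' c'.last.slim
  have hopenmap : IsOpenMap (M.toCore b X).arith :=
    isOpenMap_of_isOpen_range (M.toCore b X).arith (M.toCore_isOpenInjective b X).isOpen_range_arith
  intro x
  refine hslim.eq_of_eqOn_of_isOpen_map (Θ.toMonoidHom.comp (M.toCore b X).arith.toMonoidHom)
    ((M.toCore b' X').arith.toMonoidHom.comp Φ.hom.arith.toMonoidHom) (fun K hK => ?_) hWo hagree x
  have hK' : ((K.map (Θ.toMonoidHom.comp (M.toCore b X).arith.toMonoidHom) : Subgroup _) : Set _) =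
      Θ.toHomeomorph '' ((M.toCore b X).arith '' (K : Set _)) := by
    rw [Subgroup.coe_map, Set.image_image]
    rfl
  rw [hK']
  exact Θ.toHomeomorph.isOpenMap _ (hopenmap _ hK)

end EllipticModel

end AbsTopII

end Literature.AnabelianGeometry.AbsoluteAnabelian

end
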